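/-
Copyright (c) 2026 the pub-hodgecm-mathlib formalisation cell (harness21).  Prover seat hodgecm-mathlib-K2E5-p16 (g6), Track B «K2-LIT»,
#184♮ = hLiu418 = `stmt-HodgeConjecture-24832`; organ S2-J (LEAD F0P6-plan (g14) BATCH #17 (2), K2Liu-p05 (g5) S2-J census 12:50:24Z),
file J0-a `K2LiuArchTensorSignFramesDefs` (DEFS leaf, definition lane): the SIGN FRAME OF A TENSOR PRODUCT — for nonvanishing real vectors
`x : Fin N → ℝ`, `y : Fin M → ℝ` and an index bijection `e : Fin N × Fin M ≃ Fin n`, the positive∕non-positive index types of the Kronecker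
sign vector `z_{e(i,j)} = x_i · y_j` are `(Pos × Pos) ⊕ (Neg × Neg)` resp. `(Pos × Neg) ⊕ (Neg × Pos)` (signs multiply).
Two `def`s (the equivalences, data) + unfolding∕cardinality lemmas; no `instance`, no notation, no `sorry`.
-/
import Literature.NumberTheory.Weil1964.ArchDualPairThetaMajorants     -- ★ `PosIdx`, `NegIdx`, `signSplit`
import HarnessLib

/-!
# Crux `HLiu418`, organ S2-J, file J0-a: sign frames of a tensor product (DEFS leaf)

Cell `hodgecm-mathlib`, crux item hLiu418 = `stmt-HodgeConjecture-24832` (helper lane `--supports`, count-neutral).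

For the archimedean component at a real place `v` of the doubled∕tensor Hermitian space `𝕎 = 𝔻 ⊗ V′` the diagonal Gram vector is the
Kronecker product of the two diagonal vectors (★ F5c-A `K2LiuLocalSWTensorAdaptedBlocks.gramR_tensor`), so its sign vector is
`z_{e(i,j)} = x_i · y_j` with `x = signVec(𝔻)_v`, `y = σ_v ∘ dV′` (both nonvanishing).  This leaf names the two index equivalences
* `posIdxTensorEquiv : PosIdx z ≃ (PosIdx x × PosIdx y) ⊕ (NegIdx x × NegIdx y)`   (`𝕎_v⁺ = 𝔻⁺⊗V′⁺ ⊕ 𝔻⁻⊗V′⁻`),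
* `negIdxTensorEquiv : NegIdx z ≃ (PosIdx x × NegIdx y) ⊕ (NegIdx x × PosIdx y)`   (`𝕎_v⁻ = 𝔻⁺⊗V′⁻ ⊕ 𝔻⁻⊗V′⁺`),
with the underlying index of `inl (i, j)` ∕ `inr (i, j)` being `e (i, j)` (`_symm_apply_inl∕inr`), and the signature count
`|𝕎⁺| = p·p′ + q·q′`, `|𝕎⁻| = p·q′ + q·p′` (`card_posIdx_tensor`, `card_negIdx_tensor`) — the index bookkeeping of S2-J's
`K_w ⊗ 1 ⊆ K_𝕎` block lemma (file J0-b) and of ★ `weilRepPair_κ_hermitePi_zero`'s exponents `(−|S|, −|R|, −|Q|, −|P|)`.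
References: [Kudla1994, §2]; [KonnoKonno2007, §3.1, Lemma 5.2]; [HarrisKudlaSweet1996, §1].
HONEST LABEL: HC_CM is proved only modulo the 7 printed citations (2 remaining named inputs: hLiu418 = stmt-HodgeConjecture-24832,
h413 = stmt-HodgeConjecture-24833) until rung 0 closes; count-neutral helper, closes no socket.
-/

set_option autoImplicit false
set_option linter.dupNamespace false

noncomputable section

namespace Summit.HodgeConjecture.HodgeConjecture.Cruxes.HLiu418.K2LiuArchTensorSignFrames

open Literature.NumberTheory.Weil1964 (PosIdx NegIdx)

variable {N M n : ℕ}

/-- sign bookkeeping: for `x_i, y_j ≠ 0`, `0 < x_i·y_j` with `0 < x_i` forces `0 < y_j`. [folklore] -/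
theorem pos_right_of_mul_pos {a b : ℝ} (h : 0 < a * b) (ha : 0 < a) : 0 < b := by
  rcases mul_pos_iff.1 h with ⟨-, hb⟩ | ⟨ha', -⟩
  · exact hb
  · exact absurd ha (lt_asymm ha')

/-- sign bookkeeping: `0 < x_i·y_j` with `¬0 < x_i` forces `¬0 < y_j`. [folklore] -/
theorem not_pos_right_of_mul_pos {a b : ℝ} (h : 0 < a * b) (ha : ¬0 < a) : ¬0 < b := by
  rcases mul_pos_iff.1 h with ⟨ha', -⟩ | ⟨-, hb⟩
  · exact absurd ha' ha
  · exact lt_asymm hb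

/-- sign bookkeeping: `¬0 < x_i·y_j` (with `x_i, y_j ≠ 0`) and `0 < x_i` force `¬0 < y_j`. [folklore] -/
theorem not_pos_right_of_not_mul_pos {a b : ℝ} (h : ¬0 < a * b) (ha : 0 < a) : ¬0 < b :=
  fun hb => h (mul_pos ha hb)

/-- sign bookkeeping: `¬0 < x_i·y_j`, `¬0 < x_i`, `x_i ≠ 0`, `y_j ≠ 0` force `0 < y_j`. [folklore] -/
theorem pos_right_of_not_mul_pos {a b : ℝ} (h : ¬0 < a * b) (ha : ¬0 < a) (ha0 : a ≠ 0) (hb0 : b ≠ 0) : 0 < b := by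
  rcases lt_or_gt_of_ne hb0 with hb | hb
  · exact absurd (mul_pos_of_neg_of_neg (lt_of_le_of_ne (not_lt.1 ha) ha0) hb) h
  · exact hb

/-- **`𝕎⁺ = 𝔻⁺ ⊗ V′⁺ ⊕ 𝔻⁻ ⊗ V′⁻`**: the positive indices of the Kronecker sign vector `z_{e(i,j)} = x_i·y_j`.
[cite: KonnoKonno2007, §3.1; Kudla1994, §2] -/
def posIdxTensorEquiv (x : Fin N → ℝ) (y : Fin M → ℝ) (e : Fin N × Fin M ≃ Fin n) (hx : ∀ i, x i ≠ 0) (hy : ∀ j, y j ≠ 0) :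
    PosIdx (fun k => x (e.symm k).1 * y (e.symm k).2) ≃ (PosIdx x × PosIdx y) ⊕ (NegIdx x × NegIdx y) where
  toFun k :=
    if h : 0 < x (e.symm k.1).1 then Sum.inl (⟨(e.symm k.1).1, h⟩, ⟨(e.symm k.1).2, pos_right_of_mul_pos k.2 h⟩)
    else Sum.inr (⟨(e.symm k.1).1, h⟩, ⟨(e.symm k.1).2, not_pos_right_of_mul_pos k.2 h⟩)
  invFun := Sum.elim (fun ij => ⟨e (ij.1.1, ij.2.1), by simpa only [Equiv.symm_apply_apply] using mul_pos ij.1.2 ij.2.2⟩)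
    (fun ij => ⟨e (ij.1.1, ij.2.1), by
      simpa only [Equiv.symm_apply_apply] using
        mul_pos_of_neg_of_neg (lt_of_le_of_ne (not_lt.1 ij.1.2) (hx _)) (lt_of_le_of_ne (not_lt.1 ij.2.2) (hy _))⟩)
  left_inv k := by
    by_cases h : 0 < x (e.symm k.1).1
    · simp only [h, ↓reduceDIte, Sum.elim_inl, Prod.mk.eta, Equiv.apply_symm_apply]
    · simp only [h, ↓reduceDIte, Sum.elim_inr, Prod.mk.eta, Equiv.apply_symm_apply]
  right_inv := by
    rintro (⟨i, j⟩ | ⟨i, j⟩)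
    · simp only [Sum.elim_inl, Equiv.symm_apply_apply, i.2, ↓reduceDIte, Subtype.coe_eta]
    · simp only [Sum.elim_inr, Equiv.symm_apply_apply, i.2, ↓reduceDIte, Subtype.coe_eta]

/-- **`𝕎⁻ = 𝔻⁺ ⊗ V′⁻ ⊕ 𝔻⁻ ⊗ V′⁺`**: the non-positive indices of the Kronecker sign vector. [cite: KonnoKonno2007, §3.1; Kudla1994, §2] -/
def negIdxTensorEquiv (x : Fin N → ℝ) (y : Fin M → ℝ) (e : Fin N × Fin M ≃ Fin n) (hx : ∀ i, x i ≠ 0) (hy : ∀ j, y j ≠ 0) :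
    NegIdx (fun k => x (e.symm k).1 * y (e.symm k).2) ≃ (PosIdx x × NegIdx y) ⊕ (NegIdx x × PosIdx y) where
  toFun k :=
    if h : 0 < x (e.symm k.1).1 then Sum.inl (⟨(e.symm k.1).1, h⟩, ⟨(e.symm k.1).2, not_pos_right_of_not_mul_pos k.2 h⟩)
    else Sum.inr (⟨(e.symm k.1).1, h⟩, ⟨(e.symm k.1).2, pos_right_of_not_mul_pos k.2 h (hx _) (hy _)⟩)
  invFun := Sum.elim
    (fun ij => ⟨e (ij.1.1, ij.2.1), by
      simpa only [Equiv.symm_apply_apply, not_lt] using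
        (mul_neg_of_pos_of_neg ij.1.2 (lt_of_le_of_ne (not_lt.1 ij.2.2) (hy _))).le⟩)
    (fun ij => ⟨e (ij.1.1, ij.2.1), by
      simpa only [Equiv.symm_apply_apply, not_lt] using
        (mul_neg_of_neg_of_pos (lt_of_le_of_ne (not_lt.1 ij.1.2) (hx _)) ij.2.2).le⟩)
  left_inv k := by
    by_cases h : 0 < x (e.symm k.1).1
    · simp only [h, ↓reduceDIte, Sum.elim_inl, Prod.mk.eta, Equiv.apply_symm_apply]
    · simp only [h, ↓reduceDIte, Sum.elim_inr, Prod.mk.eta, Equiv.apply_symm_apply]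
  right_inv := by
    rintro (⟨i, j⟩ | ⟨i, j⟩)
    · simp only [Sum.elim_inl, Equiv.symm_apply_apply, i.2, ↓reduceDIte, Subtype.coe_eta]
    · simp only [Sum.elim_inr, Equiv.symm_apply_apply, i.2, ↓reduceDIte, Subtype.coe_eta]

/-- unfolding: the index under `inl (i, j)` is `e (i, j)`. [folklore] -/
theorem posIdxTensorEquiv_symm_apply_inl (x : Fin N → ℝ) (y : Fin M → ℝ) (e : Fin N × Fin M ≃ Fin n) (hx : ∀ i, x i ≠ 0)
    (hy : ∀ j, y j ≠ 0) (i : PosIdx x) (j : PosIdx y) :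
    (((posIdxTensorEquiv x y e hx hy).symm (Sum.inl (i, j))) : Fin n) = e (i.1, j.1) := rfl

/-- unfolding: the index under `inr (i, j)` is `e (i, j)`. [folklore] -/
theorem posIdxTensorEquiv_symm_apply_inr (x : Fin N → ℝ) (y : Fin M → ℝ) (e : Fin N × Fin M ≃ Fin n) (hx : ∀ i, x i ≠ 0)
    (hy : ∀ j, y j ≠ 0) (i : NegIdx x) (j : NegIdx y) :
    (((posIdxTensorEquiv x y e hx hy).symm (Sum.inr (i, j))) : Fin n) = e (i.1, j.1) := rfl

/-- unfolding: the index under `inl (i, j)` is `e (i, j)`. [folklore] -/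
theorem negIdxTensorEquiv_symm_apply_inl (x : Fin N → ℝ) (y : Fin M → ℝ) (e : Fin N × Fin M ≃ Fin n) (hx : ∀ i, x i ≠ 0)
    (hy : ∀ j, y j ≠ 0) (i : PosIdx x) (j : NegIdx y) :
    (((negIdxTensorEquiv x y e hx hy).symm (Sum.inl (i, j))) : Fin n) = e (i.1, j.1) := rfl

/-- unfolding: the index under `inr (i, j)` is `e (i, j)`. [folklore] -/
theorem negIdxTensorEquiv_symm_apply_inr (x : Fin N → ℝ) (y : Fin M → ℝ) (e : Fin N × Fin M ≃ Fin n) (hx : ∀ i, x i ≠ 0)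
    (hy : ∀ j, y j ≠ 0) (i : NegIdx x) (j : PosIdx y) :
    (((negIdxTensorEquiv x y e hx hy).symm (Sum.inr (i, j))) : Fin n) = e (i.1, j.1) := rfl

/-- the first tensor factor of the image: `(e.symm k).1` (positive branch). [folklore] -/
theorem posIdxTensorEquiv_apply_of_pos (x : Fin N → ℝ) (y : Fin M → ℝ) (e : Fin N × Fin M ≃ Fin n) (hx : ∀ i, x i ≠ 0)
    (hy : ∀ j, y j ≠ 0) (k : PosIdx (fun k => x (e.symm k).1 * y (e.symm k).2)) (h : 0 < x (e.symm k.1).1) :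
    posIdxTensorEquiv x y e hx hy k = Sum.inl (⟨(e.symm k.1).1, h⟩, ⟨(e.symm k.1).2, pos_right_of_mul_pos k.2 h⟩) :=
  dif_pos h

/-- the first tensor factor of the image: `(e.symm k).1` (non-positive branch). [folklore] -/
theorem posIdxTensorEquiv_apply_of_not_pos (x : Fin N → ℝ) (y : Fin M → ℝ) (e : Fin N × Fin M ≃ Fin n) (hx : ∀ i, x i ≠ 0)
    (hy : ∀ j, y j ≠ 0) (k : PosIdx (fun k => x (e.symm k).1 * y (e.symm k).2)) (h : ¬0 < x (e.symm k.1).1) :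
    posIdxTensorEquiv x y e hx hy k = Sum.inr (⟨(e.symm k.1).1, h⟩, ⟨(e.symm k.1).2, not_pos_right_of_mul_pos k.2 h⟩) :=
  dif_neg h

/-- **SIGNATURE COUNT `|𝕎⁺| = p·p′ + q·q′`.** [cite: KonnoKonno2007, §3.1] -/
theorem card_posIdx_tensor (x : Fin N → ℝ) (y : Fin M → ℝ) (e : Fin N × Fin M ≃ Fin n) (hx : ∀ i, x i ≠ 0) (hy : ∀ j, y j ≠ 0) :
    Fintype.card (PosIdx (fun k => x (e.symm k).1 * y (e.symm k).2)) =
      Fintype.card (PosIdx x) * Fintype.card (PosIdx y) + Fintype.card (NegIdx x) * Fintype.card (NegIdx y) := by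
  rw [Fintype.card_congr (posIdxTensorEquiv x y e hx hy), Fintype.card_sum, Fintype.card_prod, Fintype.card_prod]

/-- **SIGNATURE COUNT `|𝕎⁻| = p·q′ + q·p′`.** [cite: KonnoKonno2007, §3.1] -/
theorem card_negIdx_tensor (x : Fin N → ℝ) (y : Fin M → ℝ) (e : Fin N × Fin M ≃ Fin n) (hx : ∀ i, x i ≠ 0) (hy : ∀ j, y j ≠ 0) :
    Fintype.card (NegIdx (fun k => x (e.symm k).1 * y (e.symm k).2)) =
      Fintype.card (PosIdx x) * Fintype.card (NegIdx y) + Fintype.card (NegIdx x) * Fintype.card (PosIdx y) := by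
  rw [Fintype.card_congr (negIdxTensorEquiv x y e hx hy), Fintype.card_sum, Fintype.card_prod, Fintype.card_prod]

end Summit.HodgeConjecture.HodgeConjecture.Cruxes.HLiu418.K2LiuArchTensorSignFrames

end
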